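import Summits.CriticalPhenomena.PercolationContinuityZ3.Theorems.PercNearOneGluingNoHeavyQuantSubproductMixture
import HarnessLib

/-!
# QUANT lane R8, T-DEC: THE PAIR-FLOW CERTIFICATE, part 1 — the algebra (per-component mass of a boosted sub-forest, and the flow
# inequalities on singletons and on larger patterns)

builds on p205010 (kernel theorem, internal audit signed; external expert review pending)

Support file (`--supports stmt-CriticalPhenomena-4575`), QUANT lane seat prim-quant-census-1 (gen 27), rung R8 of
`run/shared/lean/prim/quant/LADDER.md`; memo `run/shared/lean/prim/quant/prim-quant-census-1/g27/PAIRFLOW-G27.md`.  Theorems only, standard axioms,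
no sorries.  Stand-alone algebraic lemmas used by `…QuantPairFlowCertificate` (`sdec_flaw_of_pairFlow`, part 2), kept separate so that the main proof
stays within default heartbeats and both files within the size limit.

SETTING (memo §2).  `k` siblings with gates `qᵢ`, opened means `mᵢ`; the boosted component `Q_{d,j}` drops sibling `d` and opens sibling `j` with
probability `q_j + q_d m_d / m_j` (all other roots keep `qᵢ`); a FLOW is a nonnegative `s` on ordered pairs, `τ_{d,j} = s_{d,j} q_j((1−q_j)m_j − q_d m_d)/(q_d m_d)`.
* `pairFlow_component_mass` — with weight `ε·s_{d,j}·(1−q_d)(1−q_j)q_j m_j/(q_d m_d)` the component `Q_{d,j}` puts mass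
  `π(B)·ε·(τ_{d,j} + [j ∈ B]·s_{d,j})` on every pattern `B ∌ d` (`π` = the root-pattern law) — two `field_simp; ring` identities after splitting the
  products at the dropped and at the boosted coordinate (`prod_ite_eq_of_mem`, `prod_ite_eq_of_not_mem`).
* `pairFlow_ratio_singleton` — under the NODE BALANCE `Σ_{d≠a} s_{d,a} = 1 + Σ_{j≠a} τ_{a,j}` the total ratio on a singleton is `1 + Σ τ`.
* `pairFlow_ratio_le` — under the node balance and the PAIR COVERAGE `s_{a,b} + s_{b,a} ≥ 1` the total ratio on a pattern with `≥ 2` elements is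
  `≤ 1 + Σ τ` (it equals `Σ τ + |B| − K(B)` with internal flow `K(B) ≥ |B|(|B|−1)/2 ≥ |B| − 1`).

HONEST STATUS.  Pure finite algebra; `SiblingStep` ⟺ `GateStepN`, `UPartStep`, `LightResidDECOracle`, `FarTreeRow` remain OPEN; RATE class (log\*) and the
honest sentence of `run/shared/lean/prim/quant/README.md` unchanged.  [this work]; nothing here is cited as a published result.  The gluing rows served
[cite: KozmaNitzan2024, Conjecture 3 (p. 15)]; product measure [cite: Grimmett1999, §1.3 p. 10].
-/

noncomputable section

open scoped BigOperators

namespace Summit.CriticalPhenomena.PercolationContinuityZ3.Theorems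
namespace Quant
namespace LawDec

open Finset

/-! ### Finset tools for one boosted coordinate -/

section Tools

variable {α : Type*} [DecidableEq α]

/-- product of an openness vector that differs from `f` at one coordinate `j ∈ A`. [this work] -/
theorem prod_ite_eq_of_mem (A : Finset α) (j : α) (hj : j ∈ A) (f : α → ℝ) (b : ℝ) :
    ∏ i ∈ A, (if i = j then b else f i) = b * ∏ i ∈ A.erase j, f i := by
  rw [← Finset.mul_prod_erase A _ hj, if_pos rfl]
  congr 1
  exact Finset.prod_congr rfl fun i hi => if_neg (Finset.ne_of_mem_erase hi)

/-- product of an openness vector that differs from `f` at one coordinate `j ∉ A`. [this work] -/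
theorem prod_ite_eq_of_not_mem (A : Finset α) (j : α) (hj : j ∉ A) (f : α → ℝ) (b : ℝ) :
    ∏ i ∈ A, (if i = j then b else f i) = ∏ i ∈ A, f i :=
  Finset.prod_congr rfl fun _ hi => if_neg (ne_of_mem_of_not_mem hi hj)

end Tools

/-! ### The algebra of the certificate (stand-alone lemmas, so that the main proof stays within default heartbeats) -/

section Algebra

variable {n : ℕ}

/-- **the key per-component identity**: the boosted component `Q_{d,j}` (drop `d`, boost `j` to `q_j + q_d m_d/m_j`) with weight
`ε·s_{d,j}·(1−q_d)(1−q_j) q_j m_j/(q_d m_d)` puts mass `π(B)·ε·(τ_{d,j} + [j ∈ B]·s_{d,j})` on every pattern `B ∌ d`. [this work] -/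
theorem pairFlow_component_mass (q m : Fin n → ℝ) (s : Fin n → Fin n → ℝ) (ε : ℝ) (d j : Fin n) (hdj : d ≠ j)
    (hqd : q d ≠ 0) (hmd : m d ≠ 0) (hmj : m j ≠ 0) (B : Finset (Fin n)) (hd : d ∉ B) :
    ε * (s d j * ((1 - q d) * (1 - q j) * q j * m j)) / (q d * m d) *
        ((∏ i ∈ B, (if i = j then q j + q d * m d / m j else q i)) *
          ∏ i ∈ Finset.univ.erase d \ B, (1 - (if i = j then q j + q d * m d / m j else q i)))
      = ((∏ i ∈ B, q i) * ∏ i ∈ Finset.univ \ B, (1 - q i)) *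
        (ε * (s d j * (q j * ((1 - q j) * m j - q d * m d)) / (q d * m d) + if j ∈ B then s d j else 0)) := by
  classical
  -- split off the dropped coordinate `d` from `univ \ B`
  have hsd : Finset.univ \ B = insert d (Finset.univ.erase d \ B) := by
    ext i
    by_cases hid : i = d
    · subst hid; simp [hd]
    · simp [hid]
  have hdn : d ∉ Finset.univ.erase d \ B := fun h => (Finset.mem_erase.1 (Finset.mem_sdiff.1 h).1).1 rfl
  rw [hsd, Finset.prod_insert hdn]
  have e1 : ∀ i ∈ Finset.univ.erase d \ B, (1 - (if i = j then q j + q d * m d / m j else q i))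
      = (if i = j then 1 - (q j + q d * m d / m j) else 1 - q i) := by
    intro i _; split_ifs <;> rfl
  rw [Finset.prod_congr rfl e1]
  by_cases hj : j ∈ B
  · have hjn : j ∉ Finset.univ.erase d \ B := fun h => (Finset.mem_sdiff.1 h).2 hj
    rw [prod_ite_eq_of_mem B j hj, prod_ite_eq_of_not_mem _ j hjn, ← Finset.mul_prod_erase B q hj, if_pos hj]
    have idA : ε * (s d j * ((1 - q d) * (1 - q j) * q j * m j)) / (q d * m d) * (q j + q d * m d / m j)
        = q j * (1 - q d) * (ε * (s d j * (q j * ((1 - q j) * m j - q d * m d)) / (q d * m d) + s d j)) := by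
      field_simp
      ring
    calc ε * (s d j * ((1 - q d) * (1 - q j) * q j * m j)) / (q d * m d)
          * ((q j + q d * m d / m j) * (∏ i ∈ B.erase j, q i) * ∏ i ∈ Finset.univ.erase d \ B, (1 - q i))
        = (ε * (s d j * ((1 - q d) * (1 - q j) * q j * m j)) / (q d * m d) * (q j + q d * m d / m j))
          * ((∏ i ∈ B.erase j, q i) * ∏ i ∈ Finset.univ.erase d \ B, (1 - q i)) := by ring
      _ = q j * (1 - q d) * (ε * (s d j * (q j * ((1 - q j) * m j - q d * m d)) / (q d * m d) + s d j))
          * ((∏ i ∈ B.erase j, q i) * ∏ i ∈ Finset.univ.erase d \ B, (1 - q i)) := by rw [idA]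
      _ = _ := by ring
  · have hjT : j ∈ Finset.univ.erase d \ B := Finset.mem_sdiff.2 ⟨Finset.mem_erase.2 ⟨hdj.symm, Finset.mem_univ j⟩, hj⟩
    rw [prod_ite_eq_of_not_mem B j hj, prod_ite_eq_of_mem _ j hjT (fun i => 1 - q i),
      ← Finset.mul_prod_erase (Finset.univ.erase d \ B) (fun i => 1 - q i) hjT, if_neg hj, add_zero]
    have idB : ε * (s d j * ((1 - q d) * (1 - q j) * q j * m j)) / (q d * m d) * (1 - (q j + q d * m d / m j))
        = (1 - q d) * (1 - q j) * (ε * (s d j * (q j * ((1 - q j) * m j - q d * m d)) / (q d * m d))) := by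
      field_simp
      ring
    calc ε * (s d j * ((1 - q d) * (1 - q j) * q j * m j)) / (q d * m d)
          * ((∏ i ∈ B, q i) * ((1 - (q j + q d * m d / m j)) * ∏ i ∈ (Finset.univ.erase d \ B).erase j, (1 - q i)))
        = (ε * (s d j * ((1 - q d) * (1 - q j) * q j * m j)) / (q d * m d) * (1 - (q j + q d * m d / m j)))
          * ((∏ i ∈ B, q i) * ∏ i ∈ (Finset.univ.erase d \ B).erase j, (1 - q i)) := by ring
      _ = (1 - q d) * (1 - q j) * (ε * (s d j * (q j * ((1 - q j) * m j - q d * m d)) / (q d * m d)))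
          * ((∏ i ∈ B, q i) * ∏ i ∈ (Finset.univ.erase d \ B).erase j, (1 - q i)) := by rw [idB]
      _ = _ := by ring

/-- **the `Q`-mass ratio on a singleton is `1 + Σ τ`** under the node balance `Σ_{d≠a} s d a = 1 + Σ_{j≠a} τ a j`. [this work] -/
theorem pairFlow_ratio_singleton (τ s : Fin n → Fin n → ℝ)
    (hinout : ∀ a, ∑ d ∈ Finset.univ.erase a, s d a = 1 + ∑ j ∈ Finset.univ.erase a, τ a j) (a : Fin n) :
    ∑ d, ∑ j ∈ Finset.univ.erase d,
        (if d ∈ ({a} : Finset (Fin n)) then (0 : ℝ) else τ d j + if j ∈ ({a} : Finset (Fin n)) then s d j else 0)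
      = 1 + ∑ d, ∑ j ∈ Finset.univ.erase d, τ d j := by
  classical
  have e : ∀ d : Fin n, ∑ j ∈ Finset.univ.erase d,
      (if d ∈ ({a} : Finset (Fin n)) then (0 : ℝ) else τ d j + if j ∈ ({a} : Finset (Fin n)) then s d j else 0)
      = if d = a then 0 else (∑ j ∈ Finset.univ.erase d, τ d j) + s d a := by
    intro d
    simp only [Finset.mem_singleton]
    by_cases hda : d = a
    · rw [if_pos hda]; exact Finset.sum_eq_zero fun j _ => by rw [if_pos hda]
    · rw [if_neg hda]
      simp only [hda, if_false]
      rw [Finset.sum_add_distrib, Finset.sum_ite_eq' (Finset.univ.erase d) a (fun j => s d j),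
        if_pos (Finset.mem_erase.2 ⟨Ne.symm hda, Finset.mem_univ a⟩)]
  rw [Finset.sum_congr rfl fun d _ => e d]
  have e2 : ∑ d, (if d = a then (0 : ℝ) else (∑ j ∈ Finset.univ.erase d, τ d j) + s d a)
      = ∑ d ∈ Finset.univ.erase a, ((∑ j ∈ Finset.univ.erase d, τ d j) + s d a) := by
    rw [← Finset.add_sum_erase Finset.univ _ (Finset.mem_univ a), if_pos rfl, zero_add]
    exact Finset.sum_congr rfl fun d hd => if_neg (Finset.ne_of_mem_erase hd)
  rw [e2, Finset.sum_add_distrib, hinout a,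
    ← Finset.add_sum_erase Finset.univ (fun d => ∑ j ∈ Finset.univ.erase d, τ d j) (Finset.mem_univ a)]
  ring

/-- **the `Q`-mass ratio on a pattern with at least two elements is at most `1 + Σ τ`** under the node balance and the pair coverage
`s a b + s b a ≥ 1`. [this work] -/
theorem pairFlow_ratio_le (τ s : Fin n → Fin n → ℝ)
    (hinout : ∀ a, ∑ d ∈ Finset.univ.erase a, s d a = 1 + ∑ j ∈ Finset.univ.erase a, τ a j)
    (hcov : ∀ a b : Fin n, a ≠ b → 1 ≤ s a b + s b a) (B : Finset (Fin n)) (hB : 2 ≤ B.card) :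
    ∑ d, ∑ j ∈ Finset.univ.erase d, (if d ∈ B then (0 : ℝ) else τ d j + if j ∈ B then s d j else 0)
      ≤ 1 + ∑ d, ∑ j ∈ Finset.univ.erase d, τ d j := by
  classical
  set out : Fin n → ℝ := fun d => ∑ j ∈ Finset.univ.erase d, τ d j with hout
  set inn : Fin n → ℝ := fun a => ∑ d ∈ Finset.univ.erase a, s d a with hinn
  have hio : ∀ a, inn a = 1 + out a := hinout
  have e : ∀ d : Fin n, ∑ j ∈ Finset.univ.erase d, (if d ∈ B then (0 : ℝ) else τ d j + if j ∈ B then s d j else 0)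
      = if d ∈ B then 0 else out d + ∑ j ∈ B, s d j := by
    intro d
    by_cases hdB : d ∈ B
    · rw [if_pos hdB]; exact Finset.sum_eq_zero fun j _ => by rw [if_pos hdB]
    · rw [if_neg hdB]
      simp only [hdB, if_false]
      have hsub : B ⊆ Finset.univ.erase d :=
        fun i hi => Finset.mem_erase.2 ⟨fun (h : i = d) => hdB (h ▸ hi), Finset.mem_univ i⟩
      rw [Finset.sum_add_distrib, Finset.sum_ite_mem, Finset.inter_eq_right.2 hsub]
  rw [Finset.sum_congr rfl fun d _ => e d]
  have e2 : ∑ d, (if d ∈ B then (0 : ℝ) else out d + ∑ j ∈ B, s d j)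
      = ∑ d ∈ Finset.univ \ B, (out d + ∑ j ∈ B, s d j) := by
    rw [← Finset.sum_sdiff (Finset.subset_univ B)]
    rw [Finset.sum_eq_zero (s := B) (fun d hd => by rw [if_pos hd]), add_zero]
    exact Finset.sum_congr rfl fun d hd => if_neg (Finset.mem_sdiff.1 hd).2
  rw [e2, Finset.sum_add_distrib, Finset.sum_comm]
  have e3 : ∑ d ∈ Finset.univ \ B, out d = (∑ d, out d) - ∑ d ∈ B, out d := by
    rw [← Finset.sum_sdiff (Finset.subset_univ B)]; ring
  have e4 : ∀ j ∈ B, ∑ d ∈ Finset.univ \ B, s d j = inn j - ∑ d ∈ B.erase j, s d j := by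
    intro j hj
    have hsplit : Finset.univ.erase j = (Finset.univ \ B) ∪ B.erase j := by
      ext d
      by_cases hdj : d = j
      · subst hdj; simp [hj]
      · by_cases hdB : d ∈ B <;> simp [hdj, hdB]
    have hdisj : Disjoint (Finset.univ \ B) (B.erase j) :=
      Finset.disjoint_left.2 fun d hd hd' => (Finset.mem_sdiff.1 hd).2 (Finset.mem_of_mem_erase hd')
    rw [hinn]; simp only
    rw [hsplit, Finset.sum_union hdisj]; ring
  rw [e3, Finset.sum_congr rfl e4, Finset.sum_sub_distrib, Finset.sum_congr rfl fun j _ => hio j,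
    Finset.sum_add_distrib, Finset.sum_const, nsmul_eq_mul, mul_one]
  -- the internal flow `K ≥ |B| − 1`
  set K : ℝ := ∑ j ∈ B, ∑ d ∈ B.erase j, s d j with hK
  have hK' : ∑ j ∈ B, ∑ d ∈ B.erase j, s j d = K := by
    rw [hK]
    exact Finset.sum_comm' fun a b => by
      constructor
      · rintro ⟨ha, hb⟩
        exact ⟨Finset.mem_erase.2 ⟨(Finset.ne_of_mem_erase hb).symm, ha⟩, Finset.mem_of_mem_erase hb⟩
      · rintro ⟨ha, hb⟩
        exact ⟨Finset.mem_of_mem_erase ha, Finset.mem_erase.2 ⟨(Finset.ne_of_mem_erase ha).symm, hb⟩⟩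
  have h2K : (B.card : ℝ) * ((B.card : ℝ) - 1) ≤ K + K := by
    have e6 : ∑ j ∈ B, ∑ d ∈ B.erase j, (s j d + s d j) = K + K := by
      rw [Finset.sum_congr rfl fun j _ => Finset.sum_add_distrib, Finset.sum_add_distrib, hK', hK]
    rw [← e6]
    have e5 : ∀ j ∈ B, ((B.card : ℝ) - 1) ≤ ∑ d ∈ B.erase j, (s j d + s d j) := by
      intro j hj
      have hc : ((B.erase j).card : ℝ) = (B.card : ℝ) - 1 := by
        rw [Finset.card_erase_of_mem hj, Nat.cast_sub (Finset.card_pos.2 ⟨j, hj⟩), Nat.cast_one]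
      calc ((B.card : ℝ) - 1) = ∑ d ∈ B.erase j, (1 : ℝ) := by rw [Finset.sum_const, nsmul_eq_mul, mul_one, hc]
        _ ≤ _ := Finset.sum_le_sum fun d hd => hcov j d (Finset.ne_of_mem_erase hd).symm
    calc (B.card : ℝ) * ((B.card : ℝ) - 1) = ∑ j ∈ B, ((B.card : ℝ) - 1) := by
          rw [Finset.sum_const, nsmul_eq_mul]
      _ ≤ _ := Finset.sum_le_sum e5
  have hB2 : (2 : ℝ) ≤ B.card := by exact_mod_cast hB
  have hB1 : (0 : ℝ) ≤ (B.card : ℝ) - 1 := by linarith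
  nlinarith [mul_nonneg (sub_nonneg.2 hB2) hB1]

end Algebra

end LawDec
end Quant
end Summit.CriticalPhenomena.PercolationContinuityZ3.Theorems
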